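import Summits.Parity.BatemanHorn.Theorems.AlmostPrimeZerosLinearCappedRepulsionRieszDiffScales
import HarnessLib

/-!
# One-sided Selberg–Delange for a difference of Riesz means, IV: the remaining error terms and constants
(crux stmt-Parity-11327, line `jensen-stieltjes-majorant`, stub `stub_rieszDiffEngine`)

Everything here is PROVED (theorems only).  Part of the one-sided Selberg–Delange bound for the
DIFFERENCE of two Riesz means `A₁(x+h) − A₁(x)` of a Dirichlet series `Σ a(n) n^{-s} = ζ(s)^z G(s)`
(data `SelbergDelange.RieszData R (4/5) B z a G` of the tree's contour engine
`Literature/NumberTheory/LFunctions/SelbergDelangeRieszExpansion.lean`, Montgomery–Vaughan §7.4,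
proof of Theorem 7.17): `‖A₁(x+h) − A₁(x)‖ ≤ h·x·(log x)^{Re z−1}·B·e^{c(1+R)^{3/2}}` for
`x e^{−(log log x)³} ≤ h ≤ x`, `1 ≤ R ≤ log log x` — the SIZE of the main term with every constant
explicit in `R`, no main term, no Hankel evaluation, no Taylor expansion at the branch point.

This file: the negligibility of the left sides far from and near `1` (given `β = L(1−b) ≫ ℓ³`), the
growth `keyholeConst ⌈R⌉ ≤ 28 e^{3(1+R)^{3/2}}`, the unit `x² B e^{−ℓ³−(R+1)ℓ} ≤ h x L^{σ−1} B`,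
the `R`-explicit forms of the tree's bounds for `ζ(s)^z` far from / near `1`, the eventual
conditions on `ℓ = log log x`, and the final constant.

## References

* [MontgomeryVaughan2007] H. L. Montgomery, R. C. Vaughan, *Multiplicative Number Theory I*,
  CUP 2007, §7.4, proof of Theorem 7.17 (pp. 177–178).
* [Tenenbaum2015] G. Tenenbaum, *Introduction to analytic and probabilistic number theory*, 3rd
  ed., AMS GSM 163, II.5 §§5.3–5.4.
-/

noncomputable section

open Complex Set MeasureTheory Filter Topology intervalIntegral Metric
open scoped Real Nat Interval
open Literature.Analysis.Complex Literature.Analysis.Complex.Keyhole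
open Literature.NumberTheory.LFunctions Literature.NumberTheory.LFunctions.SelbergDelange

namespace Summit.Parity.BatemanHorn.Cruxes.LinearCappedRepulsion.JensenStieltjesMajorant

namespace RieszDiff

/-- **The left sides far from `1` are negligible**:
`16π (2x)^{1+b} e^{R C₀} log(T+3)^R B ≤ x² B e^{−ℓ³ − (R+1)ℓ}` as soon as
`β = L(1 − b) ≥ (C₀ + 20) ℓ³`. [folklore] -/
theorem far_le {x L ℓ R B T C₀ b : ℝ} (hx : 1 < x) (hL : L = Real.log x) (hℓ : ℓ = Real.log L)
    (hℓ2 : 2 ≤ ℓ) (hC₀ : 0 ≤ C₀) (hR0 : 0 ≤ R) (hRℓ : R ≤ ℓ) (hB : 0 ≤ B)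
    (hT : T = Real.exp (3 * ℓ ^ 3)) (hb1 : b ≤ 1) (hβ : (C₀ + 20) * ℓ ^ 3 ≤ L * (1 - b)) :
    4 * (4 * π * ((2 * x) ^ (1 + b) * (Real.exp (R * C₀) * Real.log (T + 3) ^ R) * B)) ≤
      x ^ 2 * B * Real.exp (-ℓ ^ 3 - (R + 1) * ℓ) := by
  obtain ⟨hx0, hxL, hL0, hLℓ, hL7, hx2, -⟩ := scales hx hL hℓ hℓ2
  have hℓ3 : (2 : ℝ) ^ 3 ≤ ℓ ^ 3 := pow_le_pow_left₀ (by norm_num) hℓ2 3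
  norm_num at hℓ3
  have hℓ0 : 0 < ℓ := by linarith
  have h2x := two_mul_rpow_left_le hx hL hb1
  have hfac := far_factor_le hℓ2 hC₀ hR0 hRℓ hT
  have hπ4 : π ≤ 4 := Real.pi_lt_four.le
  obtain ⟨-, hlogT1, -⟩ := height_bounds hℓ2 hT
  have hlogT0 : 0 ≤ Real.log (T + 3) := by linarith
  have hfac0 : 0 ≤ Real.exp (R * C₀) * Real.log (T + 3) ^ R :=
    mul_nonneg (Real.exp_pos _).le (Real.rpow_nonneg hlogT0 R)
  -- LHS ≤ 256 x² B e^{−L(1−b)} e^{ℓC₀} e^{ℓ(2+3ℓ)}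
  have h1 : 4 * (4 * π * ((2 * x) ^ (1 + b) * (Real.exp (R * C₀) * Real.log (T + 3) ^ R) * B)) ≤
      256 * x ^ 2 * B * (Real.exp (-(L * (1 - b))) *
        (Real.exp (ℓ * C₀) * Real.exp (ℓ * (2 + 3 * ℓ)))) := by
    have hmain : (2 * x) ^ (1 + b) * (Real.exp (R * C₀) * Real.log (T + 3) ^ R) * B ≤
        (4 * x ^ 2 * Real.exp (-(L * (1 - b)))) *
          (Real.exp (ℓ * C₀) * Real.exp (ℓ * (2 + 3 * ℓ))) * B :=
      mul_le_mul_of_nonneg_right (mul_le_mul h2x hfac hfac0 (by positivity)) hB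
    have hlhs0 : 0 ≤ (2 * x) ^ (1 + b) * (Real.exp (R * C₀) * Real.log (T + 3) ^ R) * B :=
      mul_nonneg (mul_nonneg (by positivity) hfac0) hB
    calc 4 * (4 * π * ((2 * x) ^ (1 + b) * (Real.exp (R * C₀) * Real.log (T + 3) ^ R) * B))
        ≤ 4 * (4 * 4 * ((4 * x ^ 2 * Real.exp (-(L * (1 - b)))) *
            (Real.exp (ℓ * C₀) * Real.exp (ℓ * (2 + 3 * ℓ))) * B)) := by
          gcongr 4 * ?_
          exact mul_le_mul (by linarith) hmain hlhs0 (by norm_num)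
      _ = _ := by ring
  refine h1.trans ?_
  have h256 : (256 : ℝ) ≤ Real.exp 6 := by
    have e : Real.exp 6 = Real.exp 3 * Real.exp 3 := by rw [← Real.exp_add]; norm_num
    rw [e]; nlinarith [numerics.1]
  have hexp : Real.exp 6 * (Real.exp (-(L * (1 - b))) *
      (Real.exp (ℓ * C₀) * Real.exp (ℓ * (2 + 3 * ℓ)))) ≤
      Real.exp (-ℓ ^ 3 - (R + 1) * ℓ) := by
    rw [← Real.exp_add, ← Real.exp_add, ← Real.exp_add, Real.exp_le_exp]
    -- 6 − L(1−b) + ℓC₀ + 2ℓ + 3ℓ² ≤ −ℓ³ − (R+1)ℓ, using L(1−b) ≥ (C₀+20)ℓ³, R ≤ ℓ, ℓ ≥ 2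
    have hRl : (R + 1) * ℓ ≤ (ℓ + 1) * ℓ := mul_le_mul_of_nonneg_right (by linarith) hℓ0.le
    have hsq : 4 ≤ ℓ ^ 2 := by
      rw [sq]; exact le_trans (by norm_num : (4:ℝ) ≤ 2 * 2) (mul_le_mul hℓ2 hℓ2 (by norm_num) hℓ0.le)
    have h4ℓ : 4 * ℓ ≤ ℓ ^ 3 := by
      rw [pow_succ]; exact mul_le_mul_of_nonneg_right hsq hℓ0.le
    have h2ℓ2 : 2 * ℓ ^ 2 ≤ ℓ ^ 3 := by
      have := mul_le_mul_of_nonneg_right hℓ2 (sq_nonneg ℓ)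
      calc 2 * ℓ ^ 2 ≤ ℓ * ℓ ^ 2 := this
        _ = ℓ ^ 3 := by ring
    have hC : ℓ * C₀ ≤ C₀ * ℓ ^ 3 := by
      have := mul_le_mul_of_nonneg_left (show ℓ ≤ ℓ ^ 3 by linarith) hC₀
      linarith
    linarith
  calc 256 * x ^ 2 * B * (Real.exp (-(L * (1 - b))) *
        (Real.exp (ℓ * C₀) * Real.exp (ℓ * (2 + 3 * ℓ))))
      = x ^ 2 * B * (256 * (Real.exp (-(L * (1 - b))) *
          (Real.exp (ℓ * C₀) * Real.exp (ℓ * (2 + 3 * ℓ))))) := by ring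
    _ ≤ x ^ 2 * B * (Real.exp 6 * (Real.exp (-(L * (1 - b))) *
          (Real.exp (ℓ * C₀) * Real.exp (ℓ * (2 + 3 * ℓ))))) := by gcongr
    _ ≤ x ^ 2 * B * Real.exp (-ℓ ^ 3 - (R + 1) * ℓ) := by gcongr

/-- **The left sides near `1` are negligible**:
`16 (2x)^{1+b} e^{R M₀} e^{πR} B ((1−b)^{−R} + 2^R) ≤ x² B e^{−ℓ³ − (R+1)ℓ}` as soon as
`log(1/(1−b)) ≤ 1 + 3ℓ + Λ` and `β = L(1 − b) ≥ (M₀ + Λ + 20) ℓ³`. [folklore] -/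
theorem near_le {x L ℓ R B M₀ Λ b : ℝ} (hx : 1 < x) (hL : L = Real.log x) (hℓ : ℓ = Real.log L)
    (hℓ2 : 2 ≤ ℓ) (hM₀ : 0 ≤ M₀) (hΛ : 0 ≤ Λ) (hR0 : 0 ≤ R) (hRℓ : R ≤ ℓ) (hB : 0 ≤ B)
    (hb0 : 0 ≤ b) (hb1 : b < 1) (hlog1b : Real.log (1 / (1 - b)) ≤ 1 + 3 * ℓ + Λ)
    (hβ : (M₀ + Λ + 20) * ℓ ^ 3 ≤ L * (1 - b)) :
    4 * (4 * ((2 * x) ^ (1 + b) * Real.exp (R * M₀) * Real.exp (π * R) * B *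
      ((1 - b) ^ (-R) + 2 ^ R))) ≤
      x ^ 2 * B * Real.exp (-ℓ ^ 3 - (R + 1) * ℓ) := by
  obtain ⟨hx0, hxL, hL0, hLℓ, hL7, hx2, -⟩ := scales hx hL hℓ hℓ2
  have hℓ3 : (2 : ℝ) ^ 3 ≤ ℓ ^ 3 := pow_le_pow_left₀ (by norm_num) hℓ2 3
  norm_num at hℓ3
  have hℓ0 : 0 < ℓ := by linarith
  have h1b : 0 < 1 - b := by linarith
  have h2x := two_mul_rpow_left_le hx hL hb1.le
  have hπ4 : π ≤ 4 := Real.pi_lt_four.le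
  -- the factors
  have hlog0 : 0 ≤ Real.log (1 / (1 - b)) :=
    Real.log_nonneg (by rw [le_div_iff₀ h1b]; linarith)
  have hpow1 : (1 - b) ^ (-R) ≤ Real.exp (ℓ * (1 + 3 * ℓ + Λ)) := by
    rw [Real.rpow_def_of_pos h1b, Real.exp_le_exp]
    have e : Real.log (1 - b) * -R = R * Real.log (1 / (1 - b)) := by
      rw [one_div, Real.log_inv]; ring
    rw [e]
    calc R * Real.log (1 / (1 - b)) ≤ ℓ * Real.log (1 / (1 - b)) :=
          mul_le_mul_of_nonneg_right hRℓ hlog0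
      _ ≤ ℓ * (1 + 3 * ℓ + Λ) := mul_le_mul_of_nonneg_left hlog1b hℓ0.le
  have hpow2 : (2 : ℝ) ^ R ≤ Real.exp (ℓ * (1 + 3 * ℓ + Λ)) := by
    rw [Real.rpow_def_of_pos two_pos, Real.exp_le_exp]
    calc Real.log 2 * R ≤ 1 * ℓ := mul_le_mul numerics.2.2 hRℓ hR0 (by norm_num)
      _ ≤ ℓ * (1 + 3 * ℓ + Λ) := by nlinarith
  have hsum : (1 - b) ^ (-R) + 2 ^ R ≤ 2 * Real.exp (ℓ * (1 + 3 * ℓ + Λ)) := by linarith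
  have hexpRM : Real.exp (R * M₀) * Real.exp (π * R) ≤ Real.exp (ℓ * (M₀ + 4)) := by
    rw [← Real.exp_add, Real.exp_le_exp]
    nlinarith [mul_le_mul_of_nonneg_right hRℓ hM₀, mul_le_mul hπ4 hRℓ hR0 (by norm_num)]
  -- LHS ≤ 128 x² B e^{−L(1−b)} e^{ℓ(M₀+4)} e^{ℓ(1+3ℓ+Λ)}
  have h1 : 4 * (4 * ((2 * x) ^ (1 + b) * Real.exp (R * M₀) * Real.exp (π * R) * B *
      ((1 - b) ^ (-R) + 2 ^ R))) ≤
      128 * x ^ 2 * B * (Real.exp (-(L * (1 - b))) * Real.exp (ℓ * (M₀ + 4)) *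
        Real.exp (ℓ * (1 + 3 * ℓ + Λ))) := by
    have hmain : (2 * x) ^ (1 + b) * Real.exp (R * M₀) * Real.exp (π * R) * B *
        ((1 - b) ^ (-R) + 2 ^ R) ≤
        (4 * x ^ 2 * Real.exp (-(L * (1 - b)))) * Real.exp (ℓ * (M₀ + 4)) * B *
          (2 * Real.exp (ℓ * (1 + 3 * ℓ + Λ))) := by
      have e : (2 * x) ^ (1 + b) * Real.exp (R * M₀) * Real.exp (π * R) * B =
          (2 * x) ^ (1 + b) * (Real.exp (R * M₀) * Real.exp (π * R)) * B := by ring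
      rw [e]
      refine mul_le_mul ?_ hsum (by positivity) (by positivity)
      exact mul_le_mul_of_nonneg_right (mul_le_mul h2x hexpRM (by positivity) (by positivity)) hB
    calc 4 * (4 * ((2 * x) ^ (1 + b) * Real.exp (R * M₀) * Real.exp (π * R) * B *
          ((1 - b) ^ (-R) + 2 ^ R)))
        ≤ 4 * (4 * ((4 * x ^ 2 * Real.exp (-(L * (1 - b)))) * Real.exp (ℓ * (M₀ + 4)) * B *
            (2 * Real.exp (ℓ * (1 + 3 * ℓ + Λ))))) := by gcongr
      _ = _ := by ring
  refine h1.trans ?_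
  have h128 : (128 : ℝ) ≤ Real.exp 6 := by
    have e : Real.exp 6 = Real.exp 3 * Real.exp 3 := by rw [← Real.exp_add]; norm_num
    rw [e]; nlinarith [numerics.1]
  have hexp : Real.exp 6 * (Real.exp (-(L * (1 - b))) * Real.exp (ℓ * (M₀ + 4)) *
      Real.exp (ℓ * (1 + 3 * ℓ + Λ))) ≤ Real.exp (-ℓ ^ 3 - (R + 1) * ℓ) := by
    rw [← Real.exp_add, ← Real.exp_add, ← Real.exp_add, Real.exp_le_exp]
    -- 6 − L(1−b) + ℓ(M₀+4) + ℓ(1+3ℓ+Λ) ≤ −ℓ³ − (R+1)ℓ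
    have hRl : (R + 1) * ℓ ≤ (ℓ + 1) * ℓ := mul_le_mul_of_nonneg_right (by linarith) hℓ0.le
    have hsq : 4 ≤ ℓ ^ 2 := by
      rw [sq]; exact le_trans (by norm_num : (4:ℝ) ≤ 2 * 2) (mul_le_mul hℓ2 hℓ2 (by norm_num) hℓ0.le)
    have h4ℓ : 4 * ℓ ≤ ℓ ^ 3 := by
      rw [pow_succ]; exact mul_le_mul_of_nonneg_right hsq hℓ0.le
    have h2ℓ2 : 2 * ℓ ^ 2 ≤ ℓ ^ 3 := by
      have := mul_le_mul_of_nonneg_right hℓ2 (sq_nonneg ℓ)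
      calc 2 * ℓ ^ 2 ≤ ℓ * ℓ ^ 2 := this
        _ = ℓ ^ 3 := by ring
    have hℓ31 : 0 ≤ ℓ ^ 3 - ℓ := by linarith
    have hMΛ : ℓ * (M₀ + Λ) ≤ (M₀ + Λ) * ℓ ^ 3 := by
      have := mul_le_mul_of_nonneg_left (show ℓ ≤ ℓ ^ 3 by linarith) (add_nonneg hM₀ hΛ)
      linarith
    linarith
  calc 128 * x ^ 2 * B * (Real.exp (-(L * (1 - b))) * Real.exp (ℓ * (M₀ + 4)) *
        Real.exp (ℓ * (1 + 3 * ℓ + Λ)))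
      = x ^ 2 * B * (128 * (Real.exp (-(L * (1 - b))) * Real.exp (ℓ * (M₀ + 4)) *
          Real.exp (ℓ * (1 + 3 * ℓ + Λ)))) := by ring
    _ ≤ x ^ 2 * B * (Real.exp 6 * (Real.exp (-(L * (1 - b))) * Real.exp (ℓ * (M₀ + 4)) *
          Real.exp (ℓ * (1 + 3 * ℓ + Λ)))) := by gcongr
    _ ≤ x ^ 2 * B * Real.exp (-ℓ ^ 3 - (R + 1) * ℓ) := by gcongr

/-- **The keyhole constant grows like `e^{O(R log R)}`**:
`keyholeConst ⌈R⌉ ≤ 28 exp(3 (1 + R)^{3/2})` (`⌈R⌉! ≤ ⌈R⌉^{⌈R⌉} ≤ (R+1)^{R+1} = e^{(R+1)log(R+1)}`,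
`log(R+1) ≤ 2(R+1)^{1/2}`). [folklore] -/
theorem keyholeConst_ceil_le {R : ℝ} (hR : 0 ≤ R) :
    keyholeConst ⌈R⌉₊ ≤ 28 * Real.exp (3 * (1 + R) ^ (3 / 2 : ℝ)) := by
  set n : ℕ := ⌈R⌉₊ with hndef
  have hn : (n : ℝ) ≤ R + 1 := by
    have := Nat.ceil_lt_add_one hR; rw [← hndef] at this; exact this.le
  have hR1 : 1 ≤ 1 + R := by linarith
  have hP1 : 1 ≤ (1 + R) ^ (3 / 2 : ℝ) := Real.one_le_rpow hR1 (by norm_num)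
  -- n! 2^n ≤ e^{2(1+R)^{3/2}} e^{(1+R)^{3/2}}
  have hfact : ((n ! : ℕ) : ℝ) ≤ Real.exp (2 * (1 + R) ^ (3 / 2 : ℝ)) := by
    have h1 : ((n ! : ℕ) : ℝ) ≤ (n : ℝ) ^ n := by exact_mod_cast Nat.factorial_le_pow n
    have h2 : (n : ℝ) ^ n ≤ (R + 1) ^ n := pow_le_pow_left₀ (Nat.cast_nonneg n) hn n
    have h3 : (R + 1) ^ n ≤ Real.exp (2 * (1 + R) ^ (3 / 2 : ℝ)) := by
      rw [← Real.rpow_natCast]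
      calc (R + 1) ^ (n : ℝ) ≤ (R + 1) ^ (R + 1) :=
            Real.rpow_le_rpow_of_exponent_le (by linarith) hn
        _ = Real.exp ((R + 1) * Real.log (R + 1)) := by
            rw [Real.rpow_def_of_pos (by linarith)]; ring_nf
        _ ≤ Real.exp (2 * (1 + R) ^ (3 / 2 : ℝ)) := by
            rw [Real.exp_le_exp]
            have hlog : Real.log (R + 1) ≤ (R + 1) ^ (1 / 2 : ℝ) / (1 / 2) :=
              Real.log_le_rpow_div (by linarith) (by norm_num)
            have e : (1 + R) ^ (3 / 2 : ℝ) = (R + 1) * (R + 1) ^ (1 / 2 : ℝ) := by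
              rw [add_comm 1 R, show (3 / 2 : ℝ) = 1 + 1 / 2 by norm_num,
                Real.rpow_add (by linarith), Real.rpow_one]
            rw [e]
            have h0 : 0 ≤ (R + 1) ^ (1 / 2 : ℝ) := by positivity
            calc (R + 1) * Real.log (R + 1) ≤ (R + 1) * ((R + 1) ^ (1 / 2 : ℝ) / (1 / 2)) :=
                  mul_le_mul_of_nonneg_left hlog (by linarith)
              _ = 2 * ((R + 1) * (R + 1) ^ (1 / 2 : ℝ)) := by ring
    exact h1.trans (h2.trans h3)
  have hpow : (2 : ℝ) ^ n ≤ Real.exp ((1 + R) ^ (3 / 2 : ℝ)) := by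
    calc (2 : ℝ) ^ n ≤ Real.exp 1 ^ n :=
          pow_le_pow_left₀ (by norm_num) (by linarith [Real.add_one_le_exp (1:ℝ)]) n
      _ = Real.exp n := by rw [← Real.exp_nat_mul, mul_one]
      _ ≤ Real.exp ((1 + R) ^ (3 / 2 : ℝ)) := by
          rw [Real.exp_le_exp]
          calc (n : ℝ) ≤ 1 + R := by linarith
            _ = (1 + R) ^ (1 : ℝ) := (Real.rpow_one _).symm
            _ ≤ (1 + R) ^ (3 / 2 : ℝ) := Real.rpow_le_rpow_of_exponent_le hR1 (by norm_num)
  -- keyholeConst n ≤ 28 n! 2^n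
  have hF1 : (1 : ℝ) ≤ ((n ! : ℕ) : ℝ) := by
    exact_mod_cast Nat.one_le_iff_ne_zero.2 (Nat.factorial_ne_zero n)
  have h2n : (1 : ℝ) ≤ (2 : ℝ) ^ n := one_le_pow₀ (by norm_num)
  have hE : Real.exp (1 / 2) * (2 * Real.exp (1 / 2)) = 2 * Real.exp 1 := by
    rw [show (2 : ℝ) * Real.exp 1 = 2 * (Real.exp (1 / 2) * Real.exp (1 / 2)) by
      rw [← Real.exp_add]; norm_num]
    ring
  have he3 : Real.exp 1 ≤ 3 := numerics.2.1
  have hkc : keyholeConst n ≤ 28 * (((n ! : ℕ) : ℝ) * (2 : ℝ) ^ n) := by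
    unfold keyholeConst
    have e : 2 * ((((n ! : ℕ) : ℝ) * 2 ^ n + 2 ^ n) * Real.exp (1 / 2) * (2 * Real.exp (1 / 2))) +
        2 * Real.exp 1 * 2 ^ n =
        Real.exp 1 * (4 * (((n ! : ℕ) : ℝ) * 2 ^ n) + 6 * 2 ^ n) := by
      have : ∀ A : ℝ, A * Real.exp (1 / 2) * (2 * Real.exp (1 / 2)) = A * (2 * Real.exp 1) := by
        intro A; rw [mul_assoc, hE]
      rw [this]; ring
    rw [e]
    have hF2 : (2 : ℝ) ^ n ≤ ((n ! : ℕ) : ℝ) * 2 ^ n := by nlinarith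
    have he : Real.exp 1 ≤ 2.7182818286 := Real.exp_one_lt_d9.le
    have h0 : (0 : ℝ) ≤ 4 * (((n ! : ℕ) : ℝ) * 2 ^ n) + 6 * 2 ^ n := by positivity
    have h1 := mul_le_mul_of_nonneg_right he h0
    linarith
  calc keyholeConst n ≤ 28 * (((n ! : ℕ) : ℝ) * (2 : ℝ) ^ n) := hkc
    _ ≤ 28 * (Real.exp (2 * (1 + R) ^ (3 / 2 : ℝ)) * Real.exp ((1 + R) ^ (3 / 2 : ℝ))) := by
        gcongr
    _ = 28 * Real.exp (3 * (1 + R) ^ (3 / 2 : ℝ)) := by rw [← Real.exp_add]; ring_nf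

/-- **The unit**: `x² B e^{−ℓ³ − (R+1)ℓ} ≤ h x L^{σ − 1} B` for `h ≥ x e^{−ℓ³}`, `−R ≤ σ`
(`L = e^ℓ ≥ 1`). [folklore] -/
theorem unit_le {x L ℓ R B h σ : ℝ} (hx : 1 < x) (hL : L = Real.log x) (hℓ : ℓ = Real.log L)
    (hℓ2 : 2 ≤ ℓ) (hB : 0 ≤ B) (hσ : -R ≤ σ) (hh : x * Real.exp (-ℓ ^ 3) ≤ h) :
    x ^ 2 * B * Real.exp (-ℓ ^ 3 - (R + 1) * ℓ) ≤ h * x * L ^ (σ - 1) * B := by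
  obtain ⟨hx0, hxL, hL0, hLℓ, hL7, hx2, -⟩ := scales hx hL hℓ hℓ2
  have hℓ0 : 0 < ℓ := by linarith
  have hpow : Real.exp (-((R + 1) * ℓ)) ≤ L ^ (σ - 1) := by
    rw [Real.rpow_def_of_pos hL0, ← hℓ, Real.exp_le_exp]; nlinarith
  have hsplit : Real.exp (-ℓ ^ 3 - (R + 1) * ℓ) =
      Real.exp (-ℓ ^ 3) * Real.exp (-((R + 1) * ℓ)) := by
    rw [← Real.exp_add]; ring_nf
  have hh0 : 0 ≤ h := le_trans (by positivity) hh
  rw [hsplit]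
  calc x ^ 2 * B * (Real.exp (-ℓ ^ 3) * Real.exp (-((R + 1) * ℓ)))
      = (x * Real.exp (-ℓ ^ 3)) * (x * Real.exp (-((R + 1) * ℓ)) * B) := by ring
    _ ≤ h * (x * L ^ (σ - 1) * B) := mul_le_mul hh (by gcongr) (by positivity) hh0
    _ = h * x * L ^ (σ - 1) * B := by ring

/-- **`ζ(s)^z` far from `1`, with the `R`-dependence explicit**: given the absolute constant `C₀` of
`SatheSelberg.exists_norm_logZeta_sub_log_le`, `‖ζ(s)^z‖ ≤ e^{R C₀} (log(|t|+3))^R` for `‖z‖ ≤ R`,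
`s ∈ Ω`, `|t| ≥ 1` (the proof of `SelbergDelange.exists_norm_zetaPow_le_far`).
[cite: MontgomeryVaughan2007, Theorem 6.7] -/
theorem norm_zetaPow_le_far_explicit {C₀ : ℝ}
    (hbd : ∀ s : ℂ, s ∈ zfrRegion → 1 ≤ |s.im| →
      ‖logZeta₁ s - Complex.log (s - 1)‖ ≤ Real.log (Real.log (|s.im| + 3)) + C₀)
    {R : ℝ} (hR : 0 ≤ R) :
    ∀ z s : ℂ, ‖z‖ ≤ R → s ∈ zfrRegion → 1 ≤ |s.im| →
      ‖zetaPow z s‖ ≤ Real.exp (R * C₀) * Real.log (|s.im| + 3) ^ R := by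
  intro z s hz hs ht
  have hs1 : s ≠ 1 := fun h ↦ by rw [h] at ht; simp at ht; linarith
  set l : ℝ := Real.log (|s.im| + 3) with hl
  have hl1 : 1 < l := ZetaClassicalRegion.one_lt_log_abs_add_three s.im
  have hl0 : 0 < l := by linarith
  have h := hbd s hs ht
  calc ‖zetaPow z s‖ ≤ Real.exp (‖z‖ * ‖logZeta₁ s - log (s - 1)‖) := norm_zetaPow_le hs1
    _ ≤ Real.exp (R * (Real.log l + C₀)) := by
        rw [Real.exp_le_exp]
        exact mul_le_mul hz h (norm_nonneg _) hR
    _ = Real.exp (R * C₀) * l ^ R := by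
        rw [mul_add, Real.exp_add, Real.rpow_def_of_pos hl0, mul_comm (Real.log l) R]
        ring

/-- **The smooth factor near `1`, with the `R`-dependence explicit**: given the absolute constant
`M₀` of `SatheSelberg.exists_norm_logZeta₁_le_near_one`, `‖exp(z logZeta₁ s)‖ ≤ e^{R M₀}` on the
box. [folklore] -/
theorem norm_exp_mul_logZeta₁_le_explicit {M₀ : ℝ}
    (hM : ∀ s : ℂ, |s.im| ≤ 1 → 1 - zfrWidth 1 / 2 ≤ s.re → s.re ≤ 2 → ‖logZeta₁ s‖ ≤ M₀)
    {R : ℝ} (hR : 0 ≤ R) :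
    ∀ z s : ℂ, ‖z‖ ≤ R → |s.im| ≤ 1 → 1 - zfrWidth 1 / 2 ≤ s.re → s.re ≤ 2 →
      ‖exp (z * logZeta₁ s)‖ ≤ Real.exp (R * M₀) := by
  intro z s hz ht h1 h2
  calc ‖exp (z * logZeta₁ s)‖ ≤ Real.exp ‖z * logZeta₁ s‖ := norm_exp_le_exp_norm _
    _ ≤ Real.exp (R * M₀) := by
        rw [Real.exp_le_exp, norm_mul]
        exact mul_le_mul hz (hM s ht h1 h2) (norm_nonneg _) hR

/-- **The eventual conditions on `ℓ = log log x`**: for constants `A`, `K` and `ρ > 0`, eventually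
`ℓ ≥ 2`, `ℓ ≥ A`, `K ℓ⁶ ≤ e^ℓ` and `2c̄/(3ℓ³) + e^{−ℓ} ≤ ρ/4`. [folklore] -/
theorem eventually_master (A K : ℝ) {ρ : ℝ} (hρ : 0 < ρ) :
    ∀ᶠ ℓ : ℝ in atTop, 2 ≤ ℓ ∧ A ≤ ℓ ∧ K * ℓ ^ 6 ≤ Real.exp ℓ ∧
      2 * zfrConst / (3 * ℓ ^ 3) + Real.exp (-ℓ) ≤ ρ / 4 := by
  have h1 : ∀ᶠ ℓ : ℝ in atTop, 2 ≤ ℓ := eventually_ge_atTop 2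
  have h2 : ∀ᶠ ℓ : ℝ in atTop, A ≤ ℓ := eventually_ge_atTop A
  have h3 : ∀ᶠ ℓ : ℝ in atTop, K * ℓ ^ 6 ≤ Real.exp ℓ := by
    have ht := Real.tendsto_pow_mul_exp_neg_atTop_nhds_zero 6
    have hK : (0 : ℝ) < 1 / (|K| + 1) := by positivity
    have hev := (tendsto_order.1 ht).2 _ hK
    filter_upwards [hev] with ℓ hℓ
    have hℓ' : ℓ ^ 6 * Real.exp (-ℓ) < 1 / (|K| + 1) := hℓ
    have hpos : 0 < Real.exp ℓ := Real.exp_pos ℓ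
    have e' : Real.exp (-ℓ) * Real.exp ℓ = 1 := by rw [← Real.exp_add]; simp
    have h0 : 0 ≤ ℓ ^ 6 * Real.exp (-ℓ) := by positivity
    calc K * ℓ ^ 6 ≤ |K| * ℓ ^ 6 := by
          exact mul_le_mul_of_nonneg_right (le_abs_self K) (by positivity)
      _ = |K| * (ℓ ^ 6 * Real.exp (-ℓ)) * Real.exp ℓ := by rw [mul_assoc, mul_assoc, e', mul_one]
      _ ≤ |K| * (1 / (|K| + 1)) * Real.exp ℓ := by gcongr
      _ ≤ 1 * Real.exp ℓ := by
          refine mul_le_mul_of_nonneg_right ?_ hpos.le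
          rw [mul_one_div, div_le_one (by positivity)]; linarith
      _ = Real.exp ℓ := one_mul _
  have h4 : ∀ᶠ ℓ : ℝ in atTop, 2 * zfrConst / (3 * ℓ ^ 3) + Real.exp (-ℓ) ≤ ρ / 4 := by
    have t1 : Tendsto (fun ℓ : ℝ ↦ 2 * zfrConst / (3 * ℓ ^ 3)) atTop (𝓝 0) := by
      have : Tendsto (fun ℓ : ℝ ↦ 3 * ℓ ^ 3) atTop atTop :=
        (tendsto_pow_atTop (by norm_num : (3:ℕ) ≠ 0)).const_mul_atTop (by norm_num)
      exact tendsto_const_nhds.div_atTop this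
    have t2 : Tendsto (fun ℓ : ℝ ↦ Real.exp (-ℓ)) atTop (𝓝 0) :=
      Real.tendsto_exp_neg_atTop_nhds_zero
    have t := t1.add t2
    rw [add_zero] at t
    have hρ4 : (0 : ℝ) < ρ / 4 := by positivity
    filter_upwards [(tendsto_order.1 t).2 _ hρ4] with ℓ hℓ using hℓ.le
  filter_upwards [h1, h2, h3, h4] with ℓ a b c d using ⟨a, b, c, d⟩

/-- **The final constant**: `1 + 5 E kC ≤ e^{(12 + M₀) P}` when `E ≤ e^{(4+M₀)P}`, `kC ≤ 28 e^{3P}`,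
`P ≥ 1` (`141 ≤ e⁵`). [folklore] -/
theorem final_constant_le {M₀ P E kC : ℝ} (hM₀ : 0 ≤ M₀) (hP1 : 1 ≤ P)
    (hE : E ≤ Real.exp ((4 + M₀) * P)) (hkc : kC ≤ 28 * Real.exp (3 * P)) (hkc0 : 0 ≤ kC) :
    1 + 5 * E * kC ≤ Real.exp ((12 + M₀) * P) := by
  have h1 : 5 * E * kC ≤ 140 * Real.exp ((4 + M₀) * P) * Real.exp (3 * P) := by
    calc 5 * E * kC ≤ 5 * Real.exp ((4 + M₀) * P) * (28 * Real.exp (3 * P)) :=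
          mul_le_mul (mul_le_mul_of_nonneg_left hE (by norm_num)) hkc hkc0 (by positivity)
      _ = _ := by ring
  have h141 : (141 : ℝ) ≤ Real.exp 5 := by
    have e : Real.exp 5 = Real.exp 1 ^ 5 := by rw [← Real.exp_nat_mul]; norm_num
    rw [e]
    calc (141 : ℝ) ≤ (2.7182818283 : ℝ) ^ 5 := by norm_num
      _ ≤ Real.exp 1 ^ 5 := pow_le_pow_left₀ (by norm_num) Real.exp_one_gt_d9.le 5
  have h2 : (1 : ℝ) ≤ Real.exp ((4 + M₀) * P) * Real.exp (3 * P) := by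
    rw [← Real.exp_add]; exact Real.one_le_exp (by positivity)
  calc (1 : ℝ) + 5 * E * kC
      ≤ 141 * (Real.exp ((4 + M₀) * P) * Real.exp (3 * P)) := by linarith
    _ ≤ Real.exp 5 * (Real.exp ((4 + M₀) * P) * Real.exp (3 * P)) := by gcongr
    _ = Real.exp (5 + (4 + M₀) * P + 3 * P) := by
        rw [← Real.exp_add, ← Real.exp_add]; ring_nf
    _ ≤ Real.exp ((12 + M₀) * P) := by rw [Real.exp_le_exp]; nlinarith

end RieszDiff

/-- **Registered sub-goal `stub_rieszDiffNear` of crux stmt-Parity-11327** (part of `stub_rieszDiffEngine`):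
the negligibility of the left sides near `1` (`RieszDiff.near_le`, ∀-closed). [cite: MontgomeryVaughan2007, §7.4 pp. 177–178] -/
theorem stub_rieszDiffNear :
      ∀ (x L ℓ R B M₀ Λ b : ℝ), 1 < x → L = Real.log x → ℓ = Real.log L → 2 ≤ ℓ → 0 ≤ M₀ → 0 ≤ Λ → 0
      ≤ R → R ≤ ℓ → 0 ≤ B → 0 ≤ b → b < 1 → Real.log (1 / (1 - b)) ≤ 1 + 3 * ℓ + Λ → (M₀ + Λ + 20) *
      ℓ ^ 3 ≤ L * (1 - b) → 4 * (4 * ((2 * x) ^ (1 + b) * Real.exp (R * M₀) * Real.exp (Real.pi * R)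
      * B * ((1 - b) ^ (-R) + 2 ^ R))) ≤ x ^ 2 * B * Real.exp (-ℓ ^ 3 - (R + 1) * ℓ) :=
  fun _ _ _ _ _ _ _ _ hx hL hℓ hℓ2 hM₀ hΛ hR0 hRℓ hB hb0 hb1 hlog1b hβ =>
    RieszDiff.near_le hx hL hℓ hℓ2 hM₀ hΛ hR0 hRℓ hB hb0 hb1 hlog1b hβ

end Summit.Parity.BatemanHorn.Cruxes.LinearCappedRepulsion.JensenStieltjesMajorant
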